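import Literature.IUT.HodgeTheaters.InitialThetaData
import Literature.NumberTheory.EllipticCurves.LegendreDescentProofs
import Literature.NumberTheory.EllipticCurves.TorsionRationalDescentProofs
import HarnessLib

/-!
# Initial Θ-data: the Legendre model of `E_F` ([IUTchIV] Thm. 1.10 p. 22 / Prop. 1.8 (iv), (vi))

`Proofs` companion (theorems only; no definitions, no named facts, no instances) of
`Literature.IUT.HodgeTheaters.InitialThetaData` (abc-iut-L5-t2: the REAL [IUTchI] Def. 3.1), by the
cell `abc-iut` (seat abc-iut-L5-t12). It records, for initial Θ-data
`D : InitialThetaData F K Fbar E l P`, the elementary consequences of Def. 3.1 (b) "the `2·3`-torsion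
points of `E_F` are rational over `F`" (`torsion_six_rational`) that [IUTchIV] Thm. 1.10 uses to pass
to the "tripodal" field and the Legendre model (kurims Apr-2020 manuscript, p. 22):

> "`F_mod ⊆ F_tpd := F_mod(E_{F_mod}[2]) ⊆ F` for the 'tripodal' intermediate field obtained from
> `F_mod` by adjoining the fields of definition of the `2`-torsion points of any model of `E_F ×_F F̄`
> over `F_mod` [cf. Proposition 1.8, (ii), (iii)]. Moreover, we assume that the `(3·5)`-torsion
> points of `E_F` are defined over `F`, and that `F = … = F_tpd(√−1, E_{F_tpd}[3·5])` — i.e., that `F`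
> is obtained from `F_tpd` by adjoining `√−1`, together with the fields of definition of the
> `(3·5)`-torsion points of a model `E_{F_tpd}` of the elliptic curve `E_F ×_F F̄` over `F_tpd`
> determined by the Legendre form of the Weierstrass equation [cf., e.g., … Proposition 1.8, (vi)].
> [Thus, it follows from Proposition 1.8, (iv), that `E_F ≅ E_{F_tpd} ×_{F_tpd} F` over `F` …]"

using the real forms of Prop. 1.8 (vi) (`LegendreDescentProofs`) and (iv)
(`TorsionRationalDescentProofs`) landed in `Literature/NumberTheory/EllipticCurves/`:

* `InitialThetaData.exists_twoTorsion_roots` — the `2`-division cubic of `E_F` has its three roots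
  `e₁, e₂, e₃` in `F` (the abscissae of the points of order `2`, which are `F`-rational by Def. 3.1 (b));
* `InitialThetaData.exists_legendre_j_eq` — hence `λ := (e₃ − e₁)/(e₂ − e₁) ∈ F ∖ {0, 1}` and
  `j(E_F) = j(y² = x(x − 1)(x − λ))`: the Legendre curve, defined over `F_tpd := ℚ(λ) ⊆ F`, is a model
  of `E_F ×_F F̄` (Prop. 1.8 (vi));
* `InitialThetaData.exists_variableChange_eq_legendre` — if moreover the `3`-torsion of that Legendre
  curve is `F`-rational (which is part of "`F = F_tpd(√−1, E_{F_tpd}[3·5])`"), then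
  `E_F ≅ E_{F_tpd} ×_{F_tpd} F` over `F`: `C • E_F = ⟨0, −(1 + λ), 0, λ, 0⟩` for a change of variables
  `C` over `F` (Prop. 1.8 (iv), `l = 3`).

Nothing of the series is asserted; these are classical consequences of the typed definition
(Silverman *AEC* III.1.7, III.10.1, X.2). No side is taken on [IUTchIII] Cor. 3.12.

## References

* [Mochizuki2012] S. Mochizuki, IUT I, Def. 3.1 (b) p. 61; IUT IV, Prop. 1.8 (iv), (vi) p. 19,
  Thm. 1.10 p. 22, Cor. 2.2 p. 42.
* [SilvermanAEC2009] J. H. Silverman, *The Arithmetic of Elliptic Curves*, 2nd ed., III.1.7, X.2.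
-/

noncomputable section

open scoped Classical
open WeierstrassCurve

universe u v w

namespace Literature.IUT.HodgeTheaters

section Legendre

variable {F : Type u} {K : Type v} {Fbar : Type w} [Field F] [NumberField F] [Field K]
  [NumberField K] [Algebra F K] [Field Fbar] [Algebra F Fbar] [Algebra K Fbar]
  {E : WeierstrassCurve F} [E.IsElliptic] {l : ℕ} {P : BadPlacePredicates K}
  (D : InitialThetaData F K Fbar E l P)

namespace InitialThetaData

include D

/-- The points of order `2` of `E_F(F̄)` are `F`-rational (Def. 3.1 (b): the `2·3`-torsion is
rational over `F`; `6•T = 3•(2•T)`). [claim: Mochizuki2012, status: disputed] -/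
theorem two_torsion_rational (T : (E.baseChange Fbar).toAffine.Point) (hT : (2 : ℤ) • T = 0) :
    T ∈ Set.range (Affine.Point.baseChange (W' := E.toAffine) F Fbar) := by
  refine D.torsion_six_rational T ?_
  rw [show (6 : ℤ) = 3 * 2 by norm_num, mul_smul, hT, smul_zero]

/-- **The `2`-division cubic of `E_F` splits over `F`** (the "tripodal" situation of [IUTchIV]
Thm. 1.10 p. 22): there are `e₁, e₂, e₃ ∈ F` with
`4x³ + b₂x² + 2b₄x + b₆ = 4(x − e₁)(x − e₂)(x − e₃)` over `F̄` — the abscissae of the three points of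
order `2`, `F`-rational by Def. 3.1 (b). [claim: Mochizuki2012, status: disputed] -/
theorem exists_twoTorsion_roots :
    ∃ e₁ e₂ e₃ : F, (Cubic.map (algebraMap F Fbar) E.twoTorsionPolynomial).roots =
      {algebraMap F Fbar e₁, algebraMap F Fbar e₂, algebraMap F Fbar e₃} := by
  haveI := D.isAlgClosure
  haveI : IsAlgClosed Fbar := IsAlgClosure.isAlgClosed F
  exact E.exists_roots_eq_of_two_torsion_rational D.two_torsion_rational

/-- **[IUTchIV] Prop. 1.8 (vi) for the curve `E_F` of initial Θ-data** (Thm. 1.10 p. 22: "a model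
`E_{F_tpd}` of the elliptic curve `E_F ×_F F̄` over `F_tpd` determined by the Legendre form"): there
is `λ ∈ F`, `λ ≠ 0, 1` — indeed `λ = (e₃ − e₁)/(e₂ − e₁)` for the `F`-rational `2`-torsion abscissae,
so that `ℚ(λ) ⊆ F` — with `j(E_F) = j(y² = x(x − 1)(x − λ))`; the Legendre curve
`⟨0, −(1 + λ), 0, λ, 0⟩` is an elliptic curve over `F` (and over `ℚ(λ)`) that is a model of
`E_F ×_F F̄`. [claim: Mochizuki2012, status: disputed] -/
theorem exists_legendre_j_eq :
    ∃ la : F, la ≠ 0 ∧ la ≠ 1 ∧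
      ∃ _ : (⟨0, -(1 + la), 0, la, 0⟩ : WeierstrassCurve F).IsElliptic,
        E.j = (⟨0, -(1 + la), 0, la, 0⟩ : WeierstrassCurve F).j := by
  haveI := D.isAlgClosure
  haveI : IsAlgClosed Fbar := IsAlgClosure.isAlgClosed F
  exact E.exists_legendre_j_eq_of_two_torsion_rational D.two_torsion_rational

/-- **[IUTchIV] Thm. 1.10, p. 22: "`E_F ≅ E_{F_tpd} ×_{F_tpd} F` over `F`"** (via Prop. 1.8 (iv)) for
the curve `E_F` of initial Θ-data, in coordinates: let `e₁, e₂, e₃ ∈ F` be the roots of the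
`2`-division cubic of `E_F` (`exists_twoTorsion_roots`) and `λ = (e₃ − e₁)/(e₂ − e₁)`; if the
`3`-torsion of the Legendre curve `E_λ : y² = x(x − 1)(x − λ)` over `F̄` is `F`-rational (part of
the hypothesis "`F = F_tpd(√−1, E_{F_tpd}[3·5])`" of Thm. 1.10), then `C • E_F = E_λ` for a change of
variables `C` defined over `F` — both curves have `j(E_F) = j(E_λ)` (Prop. 1.8 (vi)) and `F`-rational
`3`-torsion (Def. 3.1 (b) for `E_F`), so Prop. 1.8 (iv) with `l = 3` applies.
[claim: Mochizuki2012, status: disputed] -/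
theorem exists_variableChange_eq_legendre {e₁ e₂ e₃ : F}
    (h3 : (Cubic.map (algebraMap F Fbar) E.twoTorsionPolynomial).roots =
      {algebraMap F Fbar e₁, algebraMap F Fbar e₂, algebraMap F Fbar e₃})
    (hE : (⟨0, -(1 + (e₃ - e₁) / (e₂ - e₁)), 0, (e₃ - e₁) / (e₂ - e₁), 0⟩ :
      WeierstrassCurve F).IsElliptic)
    (hLeg3 : ∀ T : ((⟨0, -(1 + (e₃ - e₁) / (e₂ - e₁)), 0, (e₃ - e₁) / (e₂ - e₁), 0⟩ :
        WeierstrassCurve F).baseChange Fbar).toAffine.Point, (3 : ℤ) • T = 0 →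
      T ∈ Set.range (Affine.Point.baseChange
        (W' := (⟨0, -(1 + (e₃ - e₁) / (e₂ - e₁)), 0, (e₃ - e₁) / (e₂ - e₁), 0⟩ :
          WeierstrassCurve F).toAffine) F Fbar)) :
    ∃ C : VariableChange F,
      C • E = (⟨0, -(1 + (e₃ - e₁) / (e₂ - e₁)), 0, (e₃ - e₁) / (e₂ - e₁), 0⟩ : WeierstrassCurve F) := by
  haveI := D.isAlgClosure
  haveI := D.isScalarTower
  haveI : IsAlgClosed Fbar := IsAlgClosure.isAlgClosed F
  haveI : Algebra.IsAlgebraic F Fbar := IsAlgClosure.isAlgebraic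
  haveI : IsGalois F Fbar := {}
  haveI : CharZero Fbar := charZero_of_injective_algebraMap (algebraMap F Fbar).injective
  haveI := hE
  -- `j(E_F) = j(E_λ)`: Prop. 1.8 (vi) in coordinates, pulled back to `F` along `F ↪ F̄`
  obtain ⟨-, -, hV, hj⟩ := E.algebraMap_j_eq_legendre_j_of_roots_eq h3
  have hla : (algebraMap F Fbar e₃ - algebraMap F Fbar e₁) / (algebraMap F Fbar e₂ - algebraMap F Fbar e₁)
      = algebraMap F Fbar ((e₃ - e₁) / (e₂ - e₁)) := by rw [map_div₀, map_sub, map_sub]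
  have hcurve : (⟨0, -(1 + (algebraMap F Fbar e₃ - algebraMap F Fbar e₁) /
        (algebraMap F Fbar e₂ - algebraMap F Fbar e₁)), 0, (algebraMap F Fbar e₃ - algebraMap F Fbar e₁) /
        (algebraMap F Fbar e₂ - algebraMap F Fbar e₁), 0⟩ : WeierstrassCurve Fbar) =
      (⟨0, -(1 + (e₃ - e₁) / (e₂ - e₁)), 0, (e₃ - e₁) / (e₂ - e₁), 0⟩ : WeierstrassCurve F).map
        (algebraMap F Fbar) := by
    rw [hla]
    ext <;> simp [WeierstrassCurve.map]
  have hjF : E.j = (⟨0, -(1 + (e₃ - e₁) / (e₂ - e₁)), 0, (e₃ - e₁) / (e₂ - e₁), 0⟩ :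
      WeierstrassCurve F).j := by
    -- equal equations have equal `j` (whatever the ellipticity witnesses)
    have jcongr : ∀ (W₁ W₂ : WeierstrassCurve Fbar) (h₁ : W₁.IsElliptic) (h₂ : W₂.IsElliptic),
        W₁ = W₂ → @WeierstrassCurve.j _ _ W₁ h₁ = @WeierstrassCurve.j _ _ W₂ h₂ := by
      intro W₁ W₂ h₁ h₂ h
      subst h
      rfl
    apply (algebraMap F Fbar).injective
    rw [hj, ← WeierstrassCurve.map_j _ (algebraMap F Fbar)]
    exact jcongr _ _ _ _ hcurve
  -- Prop. 1.8 (iv) with `l = 3`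
  have h2 : (2 : F) ≠ 0 := by norm_num
  have h3' : (3 : F) ≠ 0 := by norm_num
  have h3'' : ((3 : ℕ) : F) ≠ 0 := by norm_num
  refine exists_variableChange_of_j_eq_of_torsion_fixed (L := Fbar) E _ hjF h2 h3' Nat.prime_three
    le_rfl h3'' ?_ ?_
  · intro σ T hT
    have h6 : (6 : ℤ) • T = 0 := by
      rw [show (6 : ℤ) = 2 * ((3 : ℕ) : ℤ) by norm_num, mul_smul, hT, smul_zero]
    exact Affine.Point.map_algEquiv_eq_self_of_mem_range_baseChange σ (D.torsion_six_rational T h6)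
  · intro σ T hT
    have h3T : (3 : ℤ) • T = 0 := by exact_mod_cast hT
    exact Affine.Point.map_algEquiv_eq_self_of_mem_range_baseChange σ (hLeg3 T h3T)

end InitialThetaData

end Legendre

end Literature.IUT.HodgeTheaters
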